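import Literature.NumberTheory.Sieve.MoebiusCoprimeProgressions
import Literature.NumberTheory.LFunctions.AbelPowerBound
import HarnessLib

/-!
# Polymath 8a, Lemma 3.4 (iii), Möbius pieces: Siegel–Walfisz for `μ` in progressions with a coprimality condition, uniformly and with smooth weights

Support file for the named fact `Literature.NumberTheory.Sieve.mpz_of_lt` (**parity.S29**,
`ParityWave0.lean`): D. H. J. Polymath, *New equidistribution estimates of Zhang type*, Algebra &
Number Theory 8:9 (2014) 2067–2199 = arXiv:1402.0811.  Lemma 3.4 (iii) (§3) needs the
Siegel–Walfisz property (Definition 2.5 (ii), with the coprimality restriction `(n, r) = 1`) of the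
pieces `α_k = ψ_{N_k} μ_≤` (`k ≤ j`) of the Heath-Brown decomposition: "the Siegel–Walfisz property
for `α_k` when `k ≤ j` follows from the Siegel–Walfisz theorem for the Möbius function and for
Dirichlet characters (see e.g. [Siebert] or [IK, Th. 5.29]), using summation by parts to handle the
smooth cutoff, and we omit the details."  The tree PROVES the Siegel–Walfisz theorem for `μ`
(`Literature.NumberTheory.LFunctions.SiegelWalfiszMoebius_holds`) and its form with a coprimality
condition (`SiegelWalfiszMoebius.sum_coprime_progression_le`, `MoebiusCoprimeProgressions.lean`:
`|∑_{n ≤ y, n ≡ a (k), (n,q)=1} μ(n)| ≤ C 4^{ω(q)} y (log y)^{-B}` for `k ≤ (log y)^A`).  This file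
supplies the omitted details in explicit, uniform form (from the fact `SiegelWalfiszMoebius`, taken as
a hypothesis so that the import closure stays that of `MoebiusCoprimeProgressions`):

* `sum_moebius_coprime_progression_le_uniform` — the same bound for all lengths `1 ≤ t ≤ x` with the
  modulus measured against `log x`: `|∑_{n ≤ t, …} μ(n)| ≤ C 4^{ω(r)} x (log x)^{-B}` for
  `k ≤ (log x)^A` (Siegel–Walfisz at `y = t ≥ max(√x, e^4)`, trivial bound below;
  `exists_log_rpow_le_sqrt` is the growth lemma `(log x)^B ≤ C √x`);
* `abs_sum_mul_le_of_partialSum_le` — Abel summation against a weight with a uniform bound on the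
  partial sums (real form of the tree's `AbelPowerBound.norm_sum_mul_le_of_partialSum_le`, Mathlib's
  `sum_mul_eq_sub_integral_mul₀'`);
* `sum_moebius_coprime_progression_smooth_le` — **the smooth cutoff**:
  `|∑_{n ≤ x, n ≡ a (k), (n,r)=1} w(n) μ(n)| ≤ C 4^{ω(r)} x (log x)^{-B} (|w(⌊x⌋)| + ∫₁^{⌊x⌋} |w'|)`
  for `w` differentiable on `[1, ⌊x⌋]` with integrable derivative (`4^{ω(r)} ≤ τ(r)²`,
  `four_pow_card_primeFactors_le_sigma_zero_sq`, gives the printed `τ(qr)^{O(1)}`).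

Feeding `SiegelWalfiszMoebius_holds` (file `SiegelWalfiszMoebiusProofs.lean`) discharges the
hypothesis.  Nothing here discharges `mpz_of_lt`.

## References

* D. H. J. Polymath, *New equidistribution estimates of Zhang type*, Algebra & Number Theory 8:9
  (2014), 2067–2199, arXiv:1402.0811: Definition 2.5 (ii); Lemma 3.4 (iii) and its proof (§3).
  [cite: Polymath8a2014]
* H. L. Montgomery, R. C. Vaughan, *Multiplicative Number Theory I*, CUP 2007, §11.3 (Siegel–Walfisz
  for `μ`). [cite: MontgomeryVaughan2007]
-/

open Finset MeasureTheory
open scoped ArithmeticFunction.Moebius ArithmeticFunction.omega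

namespace Literature.NumberTheory.Sieve

namespace Polymath8a

/-- `(log x)^B ≤ C_B √x` for `x ≥ 1` (`B ≥ 0`); a private copy of the tree's growth lemma
`BFI.exists_log_rpow_le_rpow` (whose file is not imported here). [folklore] -/
theorem exists_log_rpow_le_sqrt {B : ℝ} (hB : 0 ≤ B) :
    ∃ C : ℝ, 0 < C ∧ ∀ x : ℝ, 1 ≤ x → Real.log x ^ B ≤ C * x ^ (1 / 2 : ℝ) := by
  rcases eq_or_lt_of_le hB with rfl | hB'
  · refine ⟨1, one_pos, fun x hx => ?_⟩
    rw [Real.rpow_zero, one_mul]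
    exact Real.one_le_rpow hx (by norm_num)
  · set δ : ℝ := (1 / 2) / B with hδ
    have hδ0 : 0 < δ := by positivity
    refine ⟨δ⁻¹ ^ B, by positivity, fun x hx => ?_⟩
    have hx0 : 0 ≤ x := by linarith
    have hlog : 0 ≤ Real.log x := Real.log_nonneg hx
    have h1 : Real.log x ≤ x ^ δ / δ := Real.log_le_rpow_div hx0 hδ0
    calc Real.log x ^ B ≤ (x ^ δ / δ) ^ B := Real.rpow_le_rpow hlog h1 hB
      _ = δ⁻¹ ^ B * (x ^ δ) ^ B := by
          rw [div_eq_mul_inv, Real.mul_rpow (by positivity) (by positivity), mul_comm]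
      _ = δ⁻¹ ^ B * x ^ (1 / 2 : ℝ) := by
          rw [← Real.rpow_mul hx0]
          congr 2
          rw [hδ]; field_simp

/-- **Möbius sums in progressions with a coprimality condition, uniformly in the length**
(towards the Siegel–Walfisz property of the pieces `ψ_N μ_≤` of Polymath 8a, Lemma 3.4 (iii): "the
Siegel–Walfisz property for `α_k` when `k ≤ j` follows from the Siegel–Walfisz theorem for the
Möbius function … using summation by parts to handle the smooth cutoff"): for `A > 0`, `B ≥ 0`
there is `C ≥ 0` with
`|∑_{n ≤ t, n ≡ a (k), (n,r)=1} μ(n)| ≤ C 4^{ω(r)} x (log x)^{-B}`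
for all `x ≥ 2`, `1 ≤ k ≤ (log x)^A`, `a (k)` reduced, `r ≥ 1` and all `1 ≤ t ≤ x` — the tree's
`SiegelWalfiszMoebius.sum_coprime_progression_le` at `y = t` for `t ≥ max(√x, e^4)` (where
`log t ≥ (log x)/2` and `(log x)^A ≤ (log t)^{2A}`), the trivial bound `≤ t` below.
[cite: Polymath8a2014, Lemma 3.4 (iii) (proof, case k ≤ j)] -/
theorem sum_moebius_coprime_progression_le_uniform (hSW : LFunctions.SiegelWalfiszMoebius) {A : ℝ}
    (hA : 0 < A) {B : ℝ} (hB : 0 ≤ B) :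
    ∃ C : ℝ, 0 ≤ C ∧ ∀ x : ℝ, 2 ≤ x → ∀ k : ℕ, 1 ≤ k → (k : ℝ) ≤ Real.log x ^ A →
      ∀ a : ZMod k, IsUnit a → ∀ r : ℕ, r ≠ 0 → ∀ t : ℝ, 1 ≤ t → t ≤ x →
        |∑ n ∈ (Icc 1 ⌊t⌋₊).filter (fun n : ℕ => (n : ZMod k) = a ∧ n.Coprime r), (μ n : ℝ)| ≤
          C * (4 : ℝ) ^ r.primeFactors.card * x / Real.log x ^ B := by
  obtain ⟨C₁, hC₁0, hC₁⟩ := hSW.sum_coprime_progression_le (A := 2 * A) (by positivity) hB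
  obtain ⟨C₂, hC₂0, hC₂⟩ := exists_log_rpow_le_sqrt hB
  -- constants: `C₁ 2^B` for the long range, `(1 + e^4) C₂` for the short range
  refine ⟨C₁ * 2 ^ B + (1 + Real.exp 4) * C₂, by positivity, ?_⟩
  intro x hx k hk hkx a ha r hr t ht htx
  have hx1 : 1 ≤ x := by linarith
  have hlogx : 0 < Real.log x := Real.log_pos (by linarith)
  have h4 : (1 : ℝ) ≤ (4 : ℝ) ^ r.primeFactors.card := one_le_pow₀ (by norm_num)
  have hLB : 0 < Real.log x ^ B := Real.rpow_pos_of_pos hlogx B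
  -- the trivial bound `≤ t`
  have htriv : |∑ n ∈ (Icc 1 ⌊t⌋₊).filter (fun n : ℕ => (n : ZMod k) = a ∧ n.Coprime r),
      (μ n : ℝ)| ≤ t := by
    refine (Finset.abs_sum_le_sum_abs _ _).trans ?_
    calc ∑ n ∈ (Icc 1 ⌊t⌋₊).filter (fun n : ℕ => (n : ZMod k) = a ∧ n.Coprime r), |(μ n : ℝ)|
        ≤ ∑ n ∈ (Icc 1 ⌊t⌋₊).filter (fun n : ℕ => (n : ZMod k) = a ∧ n.Coprime r), (1 : ℝ) :=
          Finset.sum_le_sum fun n _ => by exact_mod_cast ArithmeticFunction.abs_moebius_le_one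
      _ ≤ ∑ n ∈ Icc 1 ⌊t⌋₊, (1 : ℝ) :=
          Finset.sum_le_sum_of_subset_of_nonneg (Finset.filter_subset _ _) fun _ _ _ => zero_le_one
      _ = ⌊t⌋₊ := by simp
      _ ≤ t := Nat.floor_le (by linarith)
  -- the two bounds for the final constant
  have hbound_long : C₁ * (4 : ℝ) ^ r.primeFactors.card * x * 2 ^ B / Real.log x ^ B ≤
      (C₁ * 2 ^ B + (1 + Real.exp 4) * C₂) * (4 : ℝ) ^ r.primeFactors.card * x / Real.log x ^ B := by
    rw [div_le_div_iff_of_pos_right hLB]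
    have : 0 ≤ (1 + Real.exp 4) * C₂ * (4 : ℝ) ^ r.primeFactors.card * x := by positivity
    nlinarith
  have hbound_short : max (x ^ (1 / 2 : ℝ)) (Real.exp 4) ≤
      (C₁ * 2 ^ B + (1 + Real.exp 4) * C₂) * (4 : ℝ) ^ r.primeFactors.card * x / Real.log x ^ B := by
    rw [le_div_iff₀ hLB]
    have hsq : x ^ (1 / 2 : ℝ) ≤ x := by
      calc x ^ (1 / 2 : ℝ) ≤ x ^ (1 : ℝ) := Real.rpow_le_rpow_of_exponent_le hx1 (by norm_num)
        _ = x := Real.rpow_one x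
    have hlog2 : Real.log x ^ B ≤ C₂ * x ^ (1 / 2 : ℝ) := hC₂ x hx1
    have hm : max (x ^ (1 / 2 : ℝ)) (Real.exp 4) ≤ (1 + Real.exp 4) * x ^ (1 / 2 : ℝ) := by
      have h1x : 1 ≤ x ^ (1 / 2 : ℝ) := Real.one_le_rpow hx1 (by norm_num)
      refine max_le ?_ ?_ <;> nlinarith [Real.exp_pos 4]
    calc max (x ^ (1 / 2 : ℝ)) (Real.exp 4) * Real.log x ^ B
        ≤ ((1 + Real.exp 4) * x ^ (1 / 2 : ℝ)) * (C₂ * x ^ (1 / 2 : ℝ)) :=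
          mul_le_mul hm hlog2 hLB.le (by positivity)
      _ = (1 + Real.exp 4) * C₂ * x := by
          have : x ^ (1 / 2 : ℝ) * x ^ (1 / 2 : ℝ) = x := by
            rw [← Real.rpow_add (by linarith)]; norm_num
          calc ((1 + Real.exp 4) * x ^ (1 / 2 : ℝ)) * (C₂ * x ^ (1 / 2 : ℝ))
              = (1 + Real.exp 4) * C₂ * (x ^ (1 / 2 : ℝ) * x ^ (1 / 2 : ℝ)) := by ring
            _ = (1 + Real.exp 4) * C₂ * x := by rw [this]
      _ ≤ (1 + Real.exp 4) * C₂ * ((4 : ℝ) ^ r.primeFactors.card * x) := by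
          refine mul_le_mul_of_nonneg_left ?_ (by positivity)
          nlinarith
      _ ≤ (C₁ * 2 ^ B + (1 + Real.exp 4) * C₂) * (4 : ℝ) ^ r.primeFactors.card * x := by
          have : 0 ≤ C₁ * 2 ^ B * (4 : ℝ) ^ r.primeFactors.card * x := by positivity
          nlinarith
  by_cases hcase : x ^ (1 / 2 : ℝ) ≤ t ∧ Real.exp 4 ≤ t
  · -- long range: Siegel–Walfisz at `y = t`
    obtain ⟨ht1, ht2⟩ := hcase
    have ht0 : 0 < t := by linarith
    have hlogt4 : 4 ≤ Real.log t := by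
      rw [Real.le_log_iff_exp_le ht0]; exact ht2
    have ht2' : 2 ≤ t := le_trans (by have := Real.add_one_le_exp 4; linarith) ht2
    -- `log x ≤ 2 log t`
    have hlogxt : Real.log x ≤ 2 * Real.log t := by
      have : Real.log (x ^ (1 / 2 : ℝ)) ≤ Real.log t := Real.log_le_log (by positivity) ht1
      rw [Real.log_rpow (by linarith)] at this
      linarith
    -- `k ≤ (log x)^A ≤ (2 log t)^A ≤ (log t)^{2A}`
    have hk' : (k : ℝ) ≤ Real.log t ^ (2 * A) := by
      refine hkx.trans ?_
      have hlt0 : 0 < Real.log t := by linarith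
      calc Real.log x ^ A ≤ (2 * Real.log t) ^ A :=
            Real.rpow_le_rpow hlogx.le hlogxt hA.le
        _ ≤ (Real.log t * Real.log t) ^ A := by
            refine Real.rpow_le_rpow (by positivity) ?_ hA.le
            nlinarith
        _ = Real.log t ^ (2 * A) := by
            rw [← sq, ← Real.rpow_natCast, ← Real.rpow_mul hlt0.le]; norm_num
    have hmain := hC₁ t ht2' k hk hk' a ha r hr
    refine hmain.trans (le_trans ?_ hbound_long)
    -- `t/(log t)^B ≤ x 2^B/(log x)^B`
    have hlt0 : 0 < Real.log t := by linarith
    have hLtB : 0 < Real.log t ^ B := Real.rpow_pos_of_pos hlt0 B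
    rw [div_le_div_iff₀ hLtB hLB]
    have hpow : Real.log x ^ B ≤ 2 ^ B * Real.log t ^ B := by
      calc Real.log x ^ B ≤ (2 * Real.log t) ^ B := Real.rpow_le_rpow hlogx.le hlogxt hB
        _ = 2 ^ B * Real.log t ^ B := Real.mul_rpow (by norm_num) hlt0.le
    calc C₁ * (4 : ℝ) ^ r.primeFactors.card * t * Real.log x ^ B
        ≤ C₁ * (4 : ℝ) ^ r.primeFactors.card * x * (2 ^ B * Real.log t ^ B) :=
          mul_le_mul (mul_le_mul_of_nonneg_left htx (by positivity)) hpow hLB.le (by positivity)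
      _ = C₁ * (4 : ℝ) ^ r.primeFactors.card * x * 2 ^ B * Real.log t ^ B := by ring
  · -- short range: the trivial bound
    refine htriv.trans (le_trans ?_ hbound_short)
    rw [not_and_or, not_le, not_le] at hcase
    rcases hcase with h | h
    · exact h.le.trans (le_max_left _ _)
    · exact h.le.trans (le_max_right _ _)

/-- **Abel summation with a uniform bound on the partial sums** (real form of the tree's
`AbelPowerBound.norm_sum_mul_le_of_partialSum_le` with exponent `0`, the bound being required only
up to the endpoint): if `c 0 = 0`, `|∑_{k ≤ t} c_k| ≤ D` for `1 ≤ t ≤ m`, and `w` is differentiable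
on `[1, m]` with integrable derivative, then `|∑_{k ≤ m} w(k) c_k| ≤ D |w(m)| + D ∫₁^m |w'|`
(Mathlib's `sum_mul_eq_sub_integral_mul₀'`). [folklore] -/
theorem abs_sum_mul_le_of_partialSum_le {c : ℕ → ℝ} (hc : c 0 = 0) {D : ℝ} {m : ℕ} (hm : 1 ≤ m)
    (hS : ∀ t : ℝ, 1 ≤ t → t ≤ m → |∑ k ∈ Icc 0 ⌊t⌋₊, c k| ≤ D)
    {w : ℝ → ℝ} (hd : ∀ t ∈ Set.Icc (1 : ℝ) m, DifferentiableAt ℝ w t)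
    (hi : IntegrableOn (deriv w) (Set.Icc (1 : ℝ) m)) :
    |∑ k ∈ Icc 0 m, w k * c k| ≤ D * |w m| + D * ∫ t in (1 : ℝ)..m, |deriv w t| := by
  have hm' : (1 : ℝ) ≤ m := by exact_mod_cast hm
  rw [sum_mul_eq_sub_integral_mul₀' c hc m hd hi]
  have hSm := hS m hm' le_rfl
  rw [Nat.floor_natCast] at hSm
  refine (abs_sub _ _).trans (add_le_add ?_ ?_)
  · rw [abs_mul]
    calc |w m| * |∑ k ∈ Icc 0 m, c k| ≤ |w m| * D := mul_le_mul_of_nonneg_left hSm (abs_nonneg _)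
      _ = D * |w m| := mul_comm _ _
  · rw [← intervalIntegral.integral_of_le hm', ← intervalIntegral.integral_const_mul]
    have h := intervalIntegral.norm_integral_le_of_norm_le hm'
      (f := fun t => deriv w t * ∑ k ∈ Icc 0 ⌊t⌋₊, c k) (g := fun t => D * |deriv w t|)
      (Filter.Eventually.of_forall fun t ht => ?_)
      (((intervalIntegrable_iff_integrableOn_Icc_of_le hm').2 hi).abs.const_mul D)
    · simpa only [Real.norm_eq_abs] using h
    · rw [Real.norm_eq_abs, abs_mul]
      calc |deriv w t| * |∑ k ∈ Icc 0 ⌊t⌋₊, c k| ≤ |deriv w t| * D :=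
            mul_le_mul_of_nonneg_left (hS t ht.1.le ht.2) (abs_nonneg _)
        _ = D * |deriv w t| := mul_comm _ _

/-- **The Siegel–Walfisz property of the pieces `ψ_N μ_≤`, explicit form** (Polymath 8a,
Lemma 3.4 (iii), case `k ≤ j`: "follows from the Siegel–Walfisz theorem for the Möbius function and
for Dirichlet characters …, using summation by parts to handle the smooth cutoff"): for `A > 0`,
`B ≥ 0` there is `C ≥ 0` such that for all `x ≥ 2`, `1 ≤ k ≤ (log x)^A`, `a (k)` reduced, `r ≥ 1`,
and every weight `w` differentiable on `[1, ⌊x⌋]` with integrable derivative,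
`|∑_{n ≤ x, n ≡ a (k), (n,r)=1} w(n) μ(n)| ≤ C 4^{ω(r)} x (log x)^{-B} (|w(⌊x⌋)| + ∫₁^{⌊x⌋} |w'|)`
(from `sum_moebius_coprime_progression_le_uniform` by `abs_sum_mul_le_of_partialSum_le`).  For
`w = ψ_N` (and `x` the truncation point `(2x)^{1/K}` of `μ_≤`, or `ΘN`) the bracket is `≪ 1`.
[cite: Polymath8a2014, Lemma 3.4 (iii) (proof, case k ≤ j)] -/
theorem sum_moebius_coprime_progression_smooth_le (hSW : LFunctions.SiegelWalfiszMoebius) {A : ℝ}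
    (hA : 0 < A) {B : ℝ} (hB : 0 ≤ B) :
    ∃ C : ℝ, 0 ≤ C ∧ ∀ x : ℝ, 2 ≤ x → ∀ k : ℕ, 1 ≤ k → (k : ℝ) ≤ Real.log x ^ A →
      ∀ a : ZMod k, IsUnit a → ∀ r : ℕ, r ≠ 0 → ∀ w : ℝ → ℝ,
        (∀ t ∈ Set.Icc (1 : ℝ) ⌊x⌋₊, DifferentiableAt ℝ w t) →
        IntegrableOn (deriv w) (Set.Icc (1 : ℝ) ⌊x⌋₊) →
        |∑ n ∈ (Icc 1 ⌊x⌋₊).filter (fun n : ℕ => (n : ZMod k) = a ∧ n.Coprime r), w n * (μ n : ℝ)|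
          ≤ C * (4 : ℝ) ^ r.primeFactors.card * x / Real.log x ^ B *
            (|w ⌊x⌋₊| + ∫ t in (1 : ℝ)..⌊x⌋₊, |deriv w t|) := by
  classical
  obtain ⟨C, hC0, hC⟩ := sum_moebius_coprime_progression_le_uniform hSW hA hB
  refine ⟨C, hC0, fun x hx k hk hkx a ha r hr w hwd hwi => ?_⟩
  set m : ℕ := ⌊x⌋₊ with hm
  have hm1 : 1 ≤ m := Nat.one_le_floor_iff _ |>.mpr (by linarith)
  have hmx : (m : ℝ) ≤ x := Nat.floor_le (by linarith)
  set D : ℝ := C * (4 : ℝ) ^ r.primeFactors.card * x / Real.log x ^ B with hD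
  -- the coefficients
  set c : ℕ → ℝ := fun n => if (n : ZMod k) = a ∧ n.Coprime r then (μ n : ℝ) else 0 with hc
  have hc0 : c 0 = 0 := by simp [hc]
  -- partial sums of `c` are the filtered Möbius sums
  have hpart : ∀ N : ℕ, ∑ n ∈ Icc 0 N, c n =
      ∑ n ∈ (Icc 1 N).filter (fun n : ℕ => (n : ZMod k) = a ∧ n.Coprime r), (μ n : ℝ) := by
    intro N
    rw [Finset.Icc_eq_cons_Ioc (Nat.zero_le N), Finset.sum_cons, hc0, zero_add,
      ← Finset.Icc_add_one_left_eq_Ioc, zero_add, Finset.sum_filter]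
  have hS : ∀ t : ℝ, 1 ≤ t → t ≤ m → |∑ n ∈ Icc 0 ⌊t⌋₊, c n| ≤ D := fun t ht htm => by
    rw [hpart]
    exact hC x hx k hk hkx a ha r hr t ht (htm.trans hmx)
  have hmain := abs_sum_mul_le_of_partialSum_le hc0 hm1 hS hwd hwi
  -- the weighted sum
  have hsum : ∑ n ∈ Icc 0 m, w n * c n =
      ∑ n ∈ (Icc 1 m).filter (fun n : ℕ => (n : ZMod k) = a ∧ n.Coprime r), w n * (μ n : ℝ) := by
    rw [Finset.Icc_eq_cons_Ioc (Nat.zero_le m), Finset.sum_cons, hc0, mul_zero, zero_add,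
      ← Finset.Icc_add_one_left_eq_Ioc, zero_add, Finset.sum_filter]
    refine Finset.sum_congr rfl fun n _ => ?_
    simp only [hc]
    split_ifs <;> simp
  rw [hsum] at hmain
  refine hmain.trans (le_of_eq ?_)
  ring

end Polymath8a

end Literature.NumberTheory.Sieve
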